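import Summits.QuantumFields.YangMills.Theorems.BalabanUVNodesN07LinearisedAveragingKernel
import Literature.MathematicalPhysics.QuantumFieldTheory.Balaban1983to89.Node00.MultiScaleFibreChartB
import HarnessLib

/-!
# BalabanUVNodes ∕ N07 — THE KERNEL OF THE LINEARISED AVERAGING `Q_k(U₀)` IS THE FIBRE TANGENT, AND PRINT'S (82) WITH THE NAMED OPERATOR: — **BOND-DATUM EDITION** (`…N07LinearisedAveragingKernelB`, USED DECLARATIONS ONLY)

The print-datum ([Balaban1984PropagatorsII] (2.3)) (γ) twin of `Summits/…/Theorems/BalabanUVNodesN07LinearisedAveragingKernel.lean`: the declarations of the parent whose STATEMENT reads the determining datum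
(`coe_fderiv_msChart_apply_eq_qLin`, `fderiv_msChart_apply_eq_zero_iff`) and which N12's junction of record v14ᴸ uses (dag-n12-c g35 probe-2 census `UsedConstsN12RoadTyped2`, THEOREMS block), re-typed over a
BOND-LEVEL datum `𝔅 : BDetSet` (F0a `B15DeterminingSetsB`) and dag-n12-c's bond-datum chart `Node00.msChartB` (✓p774329; `msChart 𝐁 = msChartB (bondsDet 𝐁)` by `rfl`).  GENERATOR twin
(this seat's `work/g32/gen_thm.py`, block-extracted from the parent's tree bytes): namespace `…N07LinearisedAveragingKernelB`, SAME short names, `DetSet ↦ BDetSet`, `AgreeOn 𝐁 ↦ AgreeOnB 𝔅`,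
`IsMinimizer ↦ IsMinimizerB`, `bondsOf (𝐁 j) ↦ 𝔅 j`, `msChart ∕ constrCard ∕ constrEnum ∕ ConstrSet ↦ …B`, NODE 00 chart lemmas `…msChart… ↦ …msChartB…`; proofs VERBATIM; the parent's
datum-free declarations REUSED BY NAME (`open`), never copied (private plumbing excepted, №366 R2).  The parent's (b) statements are the instances `𝔅 := bondsDet 𝐁`.

Cell `pub-ymgap` (HUMAN RULINGS D-0062 ∕ D-0149), seat `pub-ymgap-dag-n12-d` g32 (R134 N12 [B15] s2; the (ii) Theorems-side re-key of N12's road at print's [II] (2.3) datum — director-ym №338 ∕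
№343 (E1)(iii-b), FLAG №16 ∕ ruling (α); dag-n12-c DESIGN memo a793b2ebc0b803bf (ii); `N12-ROAD-TWIN-ORDER-2026-08-30.md`).  Count-neutral helper of K1⁹ `stmt-QuantumFields-27364`,
`--kind proof --supports … --as helper`.  THEOREMS ONLY (0 `def`, 0 `instance`, 0 `sorry`).

HONEST FRAMING (director-ym №338 (5)).  PURELY ADDITIVE: the parent stays landed and true on its own text; nothing in it is edited; no displayed premise of any consumer is deleted or
weakened; every hypothesis of the parent stays a hypothesis.  Nothing of Bałaban's analysis asserted; N12 NOT discharged; K0⁷ ∕ K1⁹ NOT closed; counts unmoved (typed 28∕28 · discharged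
8∕27, A 8∕28; K 1∕4); one finite 𝕋⁴ programme at fixed ε — R4 closes the conditional rung `BalabanLadder.UV` only; NOT the Yang–Mills mass gap (Clay); nothing continuum ∕ ℝ⁴ ∕ OS.

PARENT's DOCSTRING (the mathematics and the citations; read the site-level `𝐁` as the bond datum `𝔅`):
# BalabanUVNodes ∕ N07 — THE KERNEL OF THE LINEARISED AVERAGING `Q_k(U₀)` IS THE FIBRE TANGENT, AND PRINT'S (82) WITH THE NAMED OPERATOR:
# `U` is critical on the fibre `Ū^k = Ū^k(U)` iff `d∕dt A(U·exp(tX))|₀ = 0` for every `X` with `Q_k(U)X = 0` (module D4-kernel of the [15] Sect. B audit of seat `pub-ymgap-dag-n07-w1`)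

Cell `pub-ymgap`, width seat `pub-ymgap-dag-n07-w1` generation 0 (DAG node N07 = [15] = [Balaban1985Variational]; item (α) of dag-n07-e's word l.26171, pointer (iii) KERNEL;
INTENT-5 l.26821).  Key K1⁷ `stmt-QuantumFields-20542`, `--kind proof --supports … --as helper`; count-neutral; THEOREMS ONLY (0 `def`).  CONSUMED BY NAME, nothing modified:
this seat's Literature definer `Node00.LinearisedAveragingAtBackground` (`dIterL` = `Q_k` on matrix fields, `qLin` = the left-trivialised `𝔰𝔲` reading, `qLin_apply`,
`hasDerivAt_coe_iter_expChart_smul`, `qLin_eq_zero_iff_hasDerivAt_zero`), n07-e's 35e `BalabanUVNodesN07CritTangentConverse` (`star_mul_deriv_mem_lieSU`, `smallBelow_of_plaqSmall`,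
`hasDerivAt_coeField_iter`, ★★★ `isCritOfRecord_iff_tangentCritical`) and 35c `BalabanUVNodesN07CritTangentAtRecord` (★★ `exists_fibreCurve_of_kernel_velocity`), 35b
`Node00.AveragingSmooth` (`coeField_iter_eq_iterM`), 35a (`expChart`), n07-w2's `Node00.MultiScaleFibreChart` (`msChart`, `fderiv_msChart_apply_of_hasDerivAt`, `coe_suProj_of_mem`,
`constrEnum`, `AgreeOn` reading), this seat's flat file `Node00.LinearisedAveragingFlat` (`qLin_one_apply`) and dag-n10-w1's
`BalabanUVNodesN12FlatChartDerivIterLin` (`smallBelow_avOfRecord_one`).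

THE PRINT.  [Balaban1985Variational] (82)–(83) p. 290: *«δA(U₀)·X = 0 for all X satisfying Q_k(U₀)X = 0»* (the tangent form of criticality on the fibre of the `k`-fold
averaging), (44)–(45) p. 285 (`Q_k(U₀)`), (3)–(5) p. 278 (the variational problem); [Balaban1987RG1] (0.4) p. 253, (0.21) p. 256.

CONTENTS.  §1 on any torus `P`, under 35b's guard `SmallBelow … k U₀`: ★ `qLin_mem_lieSU` — `(Q_k(U₀)X)(c) ∈ 𝔰𝔲(N)` (35e's closed-subgroup velocity lemma on the `SU(N)`-valued
curve `t ↦ Ū^k(U₀·exp(tX))(c)`, whose matrix velocity is the definer file's `dIterL k ↑U₀ [b ↦ U₀,b X_b] c`).  §2 under 35c∕35e's small-field letters (`t₀`-small iterated averages,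
`stokesConst·t₀ < δ_N`, `< |I|⁻¹∕16`, `k ≤ m + K`): `dIterL_apply_eq_zero_of_fibreCurve` (KERNEL ⊇ FIBRE TANGENT in operator currency: the matrix velocity `Y` of any fibre curve is
killed by `Q_k`), `qLin_eq_zero_of_fibreCurve`, `exists_fibreCurve_of_qLin_eq_zero` (KERNEL ⊆ FIBRE TANGENT at the one-scale pin, 35c's corrector curve), ★★★
`qLin_eq_zero_iff_exists_fibreCurve` — **`Q_k(U)X = 0` IFF `U·X` IS THE VELOCITY OF A CURVE INSIDE THE FIBRE `Ū^k = Ū^k(U)`**.  §3 at NODE 00's objects: ★★★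
`isCritOfRecord_iff_hasDerivAt_zero_on_ker_qLin` — **the tree's curve-form pin `IsCritOfRecord` ⟺ print's (82) with the NAMED operator: `∀ X, qLin k U X = 0 → d∕dt A(U·exp(tX))|₀ = 0`**;
and for n07-w2's MULTI-SCALE chart `msChart` (several levels at once, any determining set `𝔹`): ★★ `coe_fderiv_msChart_apply_eq_qLin` (`(DΦ(0)X)_{(j,c)} = (qLin j U X)(c)`), ★★★
`fderiv_msChart_apply_eq_zero_iff` — **`DΦ(0)X = 0 ⟺ (qLin j U X)(c) = 0` at every constrained bond `(j,c)` of `𝔹`** (the multi-scale kernel is the joint kernel of the `Q_j(U)`);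
at the FLAT background: ★ `dIterL_one_coe_mem_lieSU` ∕ ★★ `dIterL_one_coe_mem_lieSU_avOfRecord` — `(Q_k(1)↑X)(c) ∈ 𝔰𝔲(N)` (hypothesis-free at NODE 00's objects).

HONEST FRAMING: rephrasings of 35c∕35e's and n07-w2's theorems in the currency of the named operator, plus the `𝔰𝔲(N)`-membership; the fibre-tangent equivalence is at the
one-scale pin (as in 35c∕35e), the multi-scale statement is about the chart's DERIVATIVE only (surjectivity ∕ right inverse (45) stay displayed hypotheses of n07-w2's files); nothing of [15]'s estimates; N07 NOT discharged; counts unmoved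
(5∕27); one finite 𝕋⁴ programme at fixed ε — R4 closes the conditional rung `BalabanLadder.UV` only; the YM mass gap (Clay) is NOT proved by any of this.  No `sorry`, no `def`.
-/

noncomputable section

namespace Summit.QuantumFields.YangMills.BalabanUVNodes.N07LinearisedAveragingKernelB

open Literature.MathematicalPhysics.QuantumFieldTheory.Balaban1983to89.B15DeterminingSetsB

open scoped Matrix.Norms.L2Operator Topology
open Filter
open Literature.MathematicalPhysics.QuantumFieldTheory.Balaban1983to89
open Literature.MathematicalPhysics.QuantumFieldTheory.Balaban1983to89.T4Continuum (T4Family)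
open Literature.MathematicalPhysics.QuantumFieldTheory.Balaban1983to89.B15DeterminingSets
open Literature.MathematicalPhysics.QuantumFieldTheory.Balaban1983to89.BlockAveraging
open Literature.MathematicalPhysics.QuantumFieldTheory.Balaban1983to89.BlockAveragingEMLHaarAC (emlWeight)
open Literature.MathematicalPhysics.QuantumFieldTheory.Balaban1983to89.ExpMeanLog (expMeanLogSU deltaSU)
open Literature.MathematicalPhysics.QuantumFieldTheory.Balaban1983to89.T4AdjointCovarianceUnitary (lieSU)
open Literature.MathematicalPhysics.QuantumFieldTheory.Balaban1983to89.Node00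
open Summit.QuantumFields.YangMills.Theorems.BlockAvgCorrector (stokesConst)
open Summit.QuantumFields.YangMills.BalabanUVNodes.N07CritTangentConverse (star_mul_deriv_mem_lieSU smallBelow_of_plaqSmall hasDerivAt_coeField_iter
  isCritOfRecord_iff_tangentCritical)
open Summit.QuantumFields.YangMills.BalabanUVNodes.N07CritTangentAtRecord (exists_fibreCurve_of_kernel_velocity)
open Summit.QuantumFields.YangMills.BalabanUVNodes.N07LinearisedAveragingKernel (qLin_mem_lieSU)

section
variable {F : T4Family} {N : ℕ} [NeZero N]

/-- ★★ **THE DERIVATIVE OF n07-w2's MULTI-SCALE CHART IS `Q_j(U)` ON THE CONSTRAINED BONDS.**  On the fibre (`AgreeOnB 𝔅 (Ū^•(U)) W`) and under the guard below `k`, for every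
constrained bond `i ↔ (j, c)` of `𝔅` with `j ≤ k`: `(DΦ(0)X)_i = (qLin j U X)(c)` as matrices (`Φ = msChartB F N K k 𝔅 W U`; n07-w2's `fderiv_msChartB_apply_of_hasDerivAt` at the
definer file's velocity, `suProj` being the identity on `𝔰𝔲(N)` by §1). [cite: Balaban1985Variational, Sect. C (47)-(48) p.285, (82)-(83) p.290; Balaban1988Convergent, (2.10)-(2.12) p.256] -/
theorem coe_fderiv_msChart_apply_eq_qLin {K k : ℕ} {𝔅 : BDetSet (F.P K)} {W : MSField (F.P K) (SU N)} {U : GaugeField (F.P K) 0 (SU N)}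
    (hU : AgreeOnB 𝔅 (avgFamily (avOfRecord F N K) U) W) (hsb : SmallBelow (avOfRecord F N K) k U)
    (X : PBond (F.P K) 0 → lieSU (Fin N)) (i : Fin (constrCardB 𝔅 k)) :
    ((fderiv ℝ (msChartB F N K k 𝔅 W U) 0 X i : lieSU (Fin N)) : Matrix (Fin N) (Fin N) ℂ) =
      qLin (((constrEnumB 𝔅 k).symm i).1 : ℕ) U X ((constrEnumB 𝔅 k).symm i).2.1 := by
  set j : Fin (k + 1) := ((constrEnumB 𝔅 k).symm i).1 with hj
  set c : PBond (F.P K) j := ((constrEnumB 𝔅 k).symm i).2.1 with hc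
  have hcmem : c ∈ (𝔅 j) := ((constrEnumB 𝔅 k).symm i).2.2
  have hsbj : SmallBelow (avOfRecord F N K) j U := hsb.mono (Nat.le_of_lt_succ j.isLt)
  have hv := hasDerivAt_coe_iter_expChart_smul (P := F.P K) hsbj X c
  rw [fderiv_msChartB_apply_of_hasDerivAt hU hsb X i hv, coe_suProj_of_mem]
  · rw [qLin_apply, ← hU j c hcmem, ← coeField_iter_eq_iterM (j : ℕ) hsbj, coeField_apply]
    rfl
  · rw [← hU j c hcmem]
    have hm := qLin_mem_lieSU (P := F.P K) hsbj X c
    rw [qLin_apply, ← coeField_iter_eq_iterM (j : ℕ) hsbj, coeField_apply] at hm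
    exact hm

end

section
variable {F : T4Family} {N : ℕ} [NeZero N]

/-- ★★★ **THE MULTI-SCALE KERNEL.**  On the fibre and under the guard below `k`: `DΦ(0)X = 0` IFF `(Q_j(U)X)(c) = 0` at EVERY constrained bond `(j, c)` of `𝔅`, `j ≤ k` — the
kernel of the linearised multi-scale constraint of V16 stub 1 is the joint kernel of the named operators `qLin j U` on `𝔅`. [cite: Balaban1985Variational, (44)-(45) p.285, (82)-(83) p.290; Balaban1988Convergent, (2.10)-(2.12) p.256] -/
theorem fderiv_msChart_apply_eq_zero_iff {K k : ℕ} {𝔅 : BDetSet (F.P K)} {W : MSField (F.P K) (SU N)} {U : GaugeField (F.P K) 0 (SU N)}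
    (hU : AgreeOnB 𝔅 (avgFamily (avOfRecord F N K) U) W) (hsb : SmallBelow (avOfRecord F N K) k U)
    (X : PBond (F.P K) 0 → lieSU (Fin N)) :
    fderiv ℝ (msChartB F N K k 𝔅 W U) 0 X = 0 ↔
      ∀ i : Fin (constrCardB 𝔅 k), qLin (((constrEnumB 𝔅 k).symm i).1 : ℕ) U X ((constrEnumB 𝔅 k).symm i).2.1 = 0 := by
  constructor
  · intro h i
    rw [← coe_fderiv_msChart_apply_eq_qLin hU hsb X i, h]
    rfl
  · intro h
    funext i
    apply Subtype.ext
    rw [coe_fderiv_msChart_apply_eq_qLin hU hsb X i, h i]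
    rfl

end

end Summit.QuantumFields.YangMills.BalabanUVNodes.N07LinearisedAveragingKernelB

end
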